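import Summits.QuantumFields.BalabanUV.Beta.GAN24.OrderZeroSlotLaw
import Summits.QuantumFields.BalabanUV.Beta.GAN24.SoftColumnCovarianceChain

/-!
# `BalabanUV.Beta.GAN24.SoftColumnOrderZeroChain` — binder row G-an2-4 ∕ (CONV-C), route R7 «TWO CURRENCIES», S4 EXECUTED ON TYPED BAŁABAN
# OBJECTS WITH AN ORDER-ZERO OPERATOR SLOT, UNCONDITIONALLY: the chain `W^R_k(μ,μ′)(p,r) = ⟨M̃_ke_p, (∇_μᴴ𝒢_k∇_{μ′})M̃_ke_r⟩ =
# ⟨∇_μu_p, 𝒢_k∇_{μ′}u_r⟩` of NE2-P1's `U = 1` soft tower is entrywise Cauchy at rate `θ₁ = L⁻¹` — the (ρ2) chain of R7, by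
# `OrderZeroSlotLaw` (the face-planted King law) and `opNorm_Mtil_succ_sub_le`, NO letter, NO weights

NOT IN PRINT; OUR PROOF ATTEMPT (prover part P3 of row G-an2-4, fibre∕strip («Woodbury») lineage, gen 26; CRUX TEAM (2), ruling «YM
REDIRECT TOWARDS THE SUMMIT», 2026-08-21).  HONEST DEPENDENCY (cell records, verbatim): «continuum YM on T⁴ ⇐ BetaPertH ∧ nine spine
estimates (0/9 proved); BetaPertH ⇐ (D1) ∧ (D4) ∧ CAP+tail; G-an2-4 gates asym, D1 and NE2/3/4.»  HONEST FRAMING (cell contract, verbatim):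
«discharging `BetaPertH` makes Bałaban's UV stability UNCONDITIONAL — a real constructive-QFT result; it is NOT the continuum limit and NOT
the Clay problem.»  ABSOLUTE RULE: nothing printed is a hypothesis; no `def … : Prop`, no sorry; [folklore] algebra over TREE objects BY NAME.

## What is proved (R7-S4 for the ORDER-ZERO-slot chain; all `U = 1`, every torus `M`, every `L ≥ 1`, `d ≥ 1`, `a > 0`; NO letter)

`HOME/beta/ROUTES-GAN24.md` v8.1 §2 R7: S3 (ρ2) «every order-zero operator in a chain must have an H¹-bounded NEIGHBOUR»; S4 «operator
slots by (ρ1)∕(ρ2)∕(ρ4) against H¹-bounded neighbours».  Companion of gen 25's `SoftColumnCovarianceChain` (order `−2` slot `𝒢`): here the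
slot is the ORDER-ZERO operator `R_k(μ,μ′) := ∇_μᴴ𝒢_k∇_{μ′}` ((P-R7a)'s `R_k`, «T_R(ℓ²→ℓ²) = 1.0000 at every k: NO RATE»), whose
neighbours are the soft legs `M̃_ke` — H¹-bounded: `‖∇_μM̃_k‖ ≤ a·Cst` ((1.89) first order).
 * §1 `opNorm_grad_Mtil_le` (`‖∇_{k,μ}M̃_k‖ ≤ a·Cst`), `Rop`∕`Ropsucc` and `‖R_k‖ ≤ Cst` (`OrderZeroSlotLaw.opNorm_fdiffH_calG_fdiff_le`);
 * §2 GENERIC LEGS: the three-slot Leibniz `legChain_sub_eq` `X₁ᴴR′Y₁ − X₀ᴴRY₀ = X₁ᴴR′(Y₁ − JY₀) + (X₁ − JX₀)ᴴR′(JY₀) + X₀ᴴ(JᴴR′J − R)Y₀`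
   and **`norm_legChain_sub_le`**: for ANY leg maps with `‖·‖ ≤ α`, one-step rates `≤ ε` and H¹ bounds `‖∇_{k,μ}X₀‖, ‖∇_{k,μ′}Y₀‖ ≤ β` of
   the COARSE legs, every entry of `X₁ᴴR_{k+1}Y₁ − X₀ᴴR_kY₀` is `≤ 2αCst·ε + β²·CK·L^{−k}` (third slot FACTORED through the gradients:
   `X₀ᴴ(JᴴR′J − R)Y₀ = (∇_μX₀)ᴴ·(K_μᴴ𝒢′K_{μ′} − 𝒢)·(∇_{μ′}Y₀)`, `OrderZeroSlotLaw.sandwich_orderZero_sub_eq_lev`) — the lemma the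
   hard ∕ dressed legs will instantiate;
 * §3 the SOFT-LEG INSTANCE `ozChain k μ μ′ := M̃_kᴴ·R_k(μ,μ′)·M̃_k` (entries `⟨∇_μu_p, 𝒢_k∇_{μ′}u_r⟩_{L²(T_η)}` for the soft legs
   `u = √(n_k^d)·M̃e`: the «gradient leg · covariance · gradient leg» chain, (P-R7a)'s V3∕V1a SHAPE without the local vertex),
   `ozChain_succ_sub_eq`, `slot₃_eq`, and **`norm_ozChain_succ_sub_le`**: `‖W^R_{k+1}(μ,μ′)(p,r) − W^R_k(μ,μ′)(p,r)‖ ≤ (2·(a·Cst)·Cst·(a·CQH) + (a·Cst)²·CK(d,L,a))·L^{−k}` —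
   UNCONDITIONAL SupRate `θ₁ = L⁻¹` for the order-zero-slot chain: slots 1–2 by `‖R′‖ ≤ Cst` × `opNorm_Mtil_succ_sub_le`, slot 3 by the
   face-planted King law against the two H¹ neighbours.  (ρ2)'s risk («where (ρ2)'s risk sits», PRICING v3.8 check #44) RETIRED for soft legs.

HONEST SCOPE.  A MODEL chain on typed objects (the SHAPE «leg · ∇ᴴ𝒢(1)∇ · leg», e.g. T1's `D*(…)D` propagator sandwich between unit-sourced
legs, WITHOUT the local vertices; no claim that it IS a Table-T row: S1∕S7 are an2's ∕ p1's); SOFT legs; `U = 1`; supplier work on the route of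
record; zero on the D1 grid; NOT (CONV-C) (a list), NOT (ρ3)(ρ5), NEVER «G-an2-4 closed», NOT D1, NOT BetaPertH, NOT continuum, NOT Clay.
Locators (text only): [Balaban1984PropagatorsI] (1.31) p. 23, (1.83) p. 31, Prop. 1.1 (1.89) p. 33; [King1986] Prop. 3.8 p. 664–665, Lemma 4.5
(4.38) p. 674.  Provenance: prover-b2b-balaban-gan24-p3-g26-0 (unit `b2b-balaban-gan24-p3`, gen 26), 2026-08-21.
-/

noncomputable section

open scoped BigOperators ComplexConjugate Matrix Matrix.Norms.L2Operator
open Finset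

namespace Summit.QuantumFields.BalabanUV.Beta.GAN24.SoftColumnOrderZeroChain

open Literature.MathematicalPhysics.QuantumFieldTheory.Balaban1983to89.B5Prop11Plancherel
open Literature.MathematicalPhysics.QuantumFieldTheory.Balaban1983to89.B5G183RateUnitTower (lev lev_neZero)
open Summit.QuantumFields.BalabanUV.T4Continuum
open Summit.QuantumFields.BalabanUV.T4Continuum.CovariantAveragingTower (Atow)
open Summit.QuantumFields.BalabanUV.T4Continuum.BalabanAveragedTowerUnit (idx lev_succ' one_le_lev' cast_lev' QBlev calGlev)
open Summit.QuantumFields.BalabanUV.T4Continuum.BalabanMinimizerLaw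
open Summit.QuantumFields.BalabanUV.T4Continuum.KingLaplacianConsistency (gradC gradF)
open Summit.QuantumFields.BalabanUV.Beta.GAN24.ChainLeibniz (norm_conjTranspose_mul_apply_le)
open Summit.QuantumFields.BalabanUV.Beta.GAN24.SoftColumnVertexRate (sqrt_pow_pos opNorm_Mtil_le)
open Summit.QuantumFields.BalabanUV.Beta.GAN24.SoftColumnCovarianceChain (calGsucc opNorm_calGsucc_le norm_conjTranspose_mul_mul_apply_le)
open Summit.QuantumFields.BalabanUV.Beta.GAN24.OrderZeroSlotLaw

variable {d : ℕ} (L : ℕ) [NeZero L] (M : Fin d → ℕ) [hM : ∀ μ, NeZero (M μ)] (a : ℝ) (ha : 0 < a)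

/-! ## §1 The gradient legs and the order-zero slot along the tower -/

/-- **`‖∇_{k,μ}·M̃_k‖ ≤ a·Cst(d,a)`**, uniformly in `k`: the soft legs are H¹-BOUNDED ((1.89) first order, `B5Prop11Plancherel.opNorm_fdiff_calG_le`,
and `‖QBtow_k‖ ≤ n_k^{−d∕2}`) — the one currency the order-zero slot needs of its neighbours. [cite: Balaban1984PropagatorsI, Prop. 1.1 (1.89)
p.33, (1.71) p.29] [folklore] -/
theorem opNorm_grad_Mtil_le (k : ℕ) (μ : Fin d) : ‖gradC (lev L k) M μ * Mtil L M a ha k‖ ≤ a * Cst d a := by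
  have ht0 := sqrt_pow_pos (d := d) L k
  have hG : ‖gradC (lev L k) M μ * calGlev L M a ha k‖ ≤ Cst d a := opNorm_fdiff_calG_le (lev L k) (one_le_lev' L k) M a ha μ
  have hA : ‖(Atow (QBlev L M) k)ᴴ‖ ≤ (Real.sqrt (((L : ℝ) ^ d) ^ k))⁻¹ := by
    rw [Matrix.l2_opNorm_conjTranspose]; exact opNorm_Atow_QBlev_le L M k
  rw [Mtil, Matrix.mul_smul, norm_smul, Complex.norm_real, Real.norm_of_nonneg (mul_nonneg ht0.le ha.le), ← Matrix.mul_assoc]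
  calc Real.sqrt (((L : ℝ) ^ d) ^ k) * a * ‖gradC (lev L k) M μ * calGlev L M a ha k * (Atow (QBlev L M) k)ᴴ‖
      ≤ Real.sqrt (((L : ℝ) ^ d) ^ k) * a * (Cst d a * (Real.sqrt (((L : ℝ) ^ d) ^ k))⁻¹) := by
        refine mul_le_mul_of_nonneg_left ?_ (mul_nonneg ht0.le ha.le)
        exact (Matrix.l2_opNorm_mul _ _).trans (mul_le_mul hG hA (norm_nonneg _) (Cst_nonneg d a))
    _ = a * Cst d a := by field_simp

/-- **THE ORDER-ZERO SLOT at level `k`**: `R_k(μ,μ′) := ∇_{k,μ}ᴴ·𝒢_k·∇_{k,μ′}` ((P-R7a)'s `R_k = ∇G_k∇*` up to the unitary shifts; norm `≤ Cst`, NO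
`ℓ² → ℓ²` rate). [cite: Balaban1984PropagatorsI, Prop. 1.1 (1.89) p.33] [folklore] -/
def Rop (k : ℕ) (μ μ' : Fin d) : Matrix (idx L M k) (idx L M k) ℂ :=
  (gradC (lev L k) M μ)ᴴ * calGlev L M a ha k * gradC (lev L k) M μ'

/-- the same slot at level `k+1`, read at the syntactic successor level `L·n_k` (identity transport; `n_{k+1} = L·n_k` definitionally).
[folklore] -/
def Ropsucc (k : ℕ) (μ μ' : Fin d) : Matrix (Tor (fine (L * lev L k) M) × Fin d) (Tor (fine (L * lev L k) M) × Fin d) ℂ :=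
  (gradF (lev L k) L M μ)ᴴ * calGsucc L M a ha k * gradF (lev L k) L M μ'

/-- `R_{k+1} = Ropsucc k` (definitional). [folklore] -/
theorem Rop_succ (k : ℕ) (μ μ' : Fin d) : Rop L M a ha (k + 1) μ μ' = Ropsucc L M a ha k μ μ' := rfl

/-- `‖R_k(μ,μ′)‖ ≤ Cst`. [cite: Balaban1984PropagatorsI, Prop. 1.1 (1.89) p.33] [folklore] -/
theorem opNorm_Rop_le (k : ℕ) (μ μ' : Fin d) : ‖Rop L M a ha k μ μ'‖ ≤ Cst d a :=
  opNorm_fdiffH_calG_fdiff_le (lev L k) (one_le_lev' L k) M a ha μ μ'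

/-- `‖Ropsucc k (μ,μ′)‖ ≤ Cst`. [folklore] -/
theorem opNorm_Ropsucc_le (k : ℕ) (μ μ' : Fin d) : ‖Ropsucc L M a ha k μ μ'‖ ≤ Cst d a :=
  opNorm_fdiffH_calG_fdiff_le (L * lev L k) (one_le_lev' L (k + 1)) M a ha μ μ'

/-! ## §2 Generic legs: the three-slot Leibniz algebra with the third slot factored, and its bound -/

section Generic

variable {κ κ' : Type*} [Fintype κ] [DecidableEq κ] [Fintype κ'] [DecidableEq κ']

omit [NeZero L] hM [Fintype κ] [DecidableEq κ] [Fintype κ'] [DecidableEq κ'] in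
/-- **LEIBNIZ (exact) for an operator slot between ANY two leg maps** (left legs `X`, right legs `Y`, fine level `₁`, coarse level `₀`):
`X₁ᴴR′Y₁ − X₀ᴴRY₀ = X₁ᴴR′(Y₁ − JY₀) + (X₁ − JX₀)ᴴR′(JY₀) + X₀ᴴ(JᴴR′J − R)Y₀`. [folklore] -/
theorem legChain_sub_eq {m n : Type*} [Fintype m] [Fintype n] (X₁ : Matrix m κ ℂ) (Y₁ : Matrix m κ' ℂ) (X₀ : Matrix n κ ℂ)
    (Y₀ : Matrix n κ' ℂ) (R' : Matrix m m ℂ) (R : Matrix n n ℂ) (J : Matrix m n ℂ) :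
    X₁ᴴ * R' * Y₁ - X₀ᴴ * R * Y₀
      = X₁ᴴ * R' * (Y₁ - J * Y₀) + (X₁ - J * X₀)ᴴ * R' * (J * Y₀) + X₀ᴴ * (Jᴴ * R' * J - R) * Y₀ := by
  have hJM : (J * X₀)ᴴ * R' * (J * Y₀) = X₀ᴴ * (Jᴴ * R' * J) * Y₀ := by
    rw [Matrix.conjTranspose_mul]
    simp only [Matrix.mul_assoc]
  rw [Matrix.mul_sub, Matrix.conjTranspose_sub, Matrix.sub_mul, Matrix.sub_mul, Matrix.mul_sub, Matrix.sub_mul, ← hJM]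
  abel

/-- **THE ORDER-ZERO-SLOT CHAIN BETWEEN GENERIC LEGS IS CAUCHY** (`d ≥ 1`): for leg maps into levels `k+1` (`X₁, Y₁`) and `k` (`X₀, Y₀`)
with `‖X₁‖, ‖Y₀‖ ≤ α`, one-step rates `‖X₁ − J_kX₀‖, ‖Y₁ − J_kY₀‖ ≤ ε` and H¹ BOUNDS `‖∇_{k,μ}X₀‖, ‖∇_{k,μ′}Y₀‖ ≤ β` of the COARSE
legs only, every entry of `X₁ᴴR_{k+1}(μ,μ′)Y₁ − X₀ᴴR_k(μ,μ′)Y₀` is `≤ 2·α·Cst·ε + β²·CK(d,L,a)·L^{−k}` — slots 1–2: the BOUNDED order-zero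
slot against the differenced value legs; slot 3: `X₀ᴴ(J_kᴴR_{k+1}J_k − R_k)Y₀ = (∇_μX₀)ᴴ·(K_μᴴ𝒢_{k+1}K_{μ′} − 𝒢_k)·(∇_{μ′}Y₀)`
(`OrderZeroSlotLaw.sandwich_orderZero_sub_eq_lev`), the face-planted King law against the two gradients.  R7 S3 (ρ2) + S4 for this slot,
as a lemma over legs. [folklore] -/
theorem norm_legChain_sub_le (hd : 1 ≤ d) (k : ℕ) (μ μ' : Fin d)
    (X₁ : Matrix (Tor (fine (L * lev L k) M) × Fin d) κ ℂ) (Y₁ : Matrix (Tor (fine (L * lev L k) M) × Fin d) κ' ℂ)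
    (X₀ : Matrix (idx L M k) κ ℂ) (Y₀ : Matrix (idx L M k) κ' ℂ) {α ε β : ℝ} (hα : 0 ≤ α) (hε : 0 ≤ ε) (hβ : 0 ≤ β)
    (hX₁ : ‖X₁‖ ≤ α) (hY₀ : ‖Y₀‖ ≤ α) (hXr : ‖X₁ - Jpc L M k * X₀‖ ≤ ε) (hYr : ‖Y₁ - Jpc L M k * Y₀‖ ≤ ε)
    (hXg : ‖gradC (lev L k) M μ * X₀‖ ≤ β) (hYg : ‖gradC (lev L k) M μ' * Y₀‖ ≤ β) (p : κ) (r : κ') :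
    ‖(X₁ᴴ * Ropsucc L M a ha k μ μ' * Y₁ - X₀ᴴ * Rop L M a ha k μ μ' * Y₀) p r‖
      ≤ 2 * (α * Cst d a * ε) + β * (CK d L a * ((L : ℝ)⁻¹) ^ k) * β := by
  have hR' : ‖Ropsucc L M a ha k μ μ'‖ ≤ Cst d a := opNorm_Ropsucc_le L M a ha k μ μ'
  have hS := opNorm_faceK_calG_faceK_sub_le_lev L M a ha hd k μ μ'
  have hCst := Cst_nonneg d a
  have hσ : 0 ≤ CK d L a * ((L : ℝ)⁻¹) ^ k := (norm_nonneg _).trans hS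
  have hJY : ‖Jpc L M k * Y₀‖ ≤ α :=
    (Matrix.l2_opNorm_mul _ _).trans ((mul_le_mul (opNorm_Jpc_le L M k) hY₀ (norm_nonneg _) zero_le_one).trans (le_of_eq (one_mul _)))
  -- the third slot, factored through the gradients of the coarse legs
  have h3 : X₀ᴴ * ((Jpc L M k)ᴴ * Ropsucc L M a ha k μ μ' * Jpc L M k - Rop L M a ha k μ μ') * Y₀
      = (gradC (lev L k) M μ * X₀)ᴴ
          * ((faceK (lev L k) L M μ)ᴴ * calG (L * lev L k) (one_le_lev' L (k + 1)) M a ha * faceK (lev L k) L M μ' - calGlev L M a ha k)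
          * (gradC (lev L k) M μ' * Y₀) := by
    have h' : (Jpc L M k)ᴴ * Ropsucc L M a ha k μ μ' * Jpc L M k - Rop L M a ha k μ μ'
        = (gradC (lev L k) M μ)ᴴ * ((faceK (lev L k) L M μ)ᴴ * calG (L * lev L k) (one_le_lev' L (k + 1)) M a ha
            * faceK (lev L k) L M μ' - calGlev L M a ha k) * gradC (lev L k) M μ' := sandwich_orderZero_sub_eq_lev L M a ha k μ μ'
    rw [h', Matrix.conjTranspose_mul]
    simp only [Matrix.mul_assoc]
  rw [legChain_sub_eq X₁ Y₁ X₀ Y₀ (Ropsucc L M a ha k μ μ') (Rop L M a ha k μ μ') (Jpc L M k), Matrix.add_apply, Matrix.add_apply, h3]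
  have t1 : ‖(X₁ᴴ * Ropsucc L M a ha k μ μ' * (Y₁ - Jpc L M k * Y₀)) p r‖ ≤ α * Cst d a * ε :=
    (norm_conjTranspose_mul_mul_apply_le _ _ _ p r).trans
      (mul_le_mul (mul_le_mul hX₁ hR' (norm_nonneg _) hα) hYr (norm_nonneg _) (mul_nonneg hα hCst))
  have t2 : ‖((X₁ - Jpc L M k * X₀)ᴴ * Ropsucc L M a ha k μ μ' * (Jpc L M k * Y₀)) p r‖ ≤ ε * Cst d a * α :=
    (norm_conjTranspose_mul_mul_apply_le _ _ _ p r).trans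
      (mul_le_mul (mul_le_mul hXr hR' (norm_nonneg _) hε) hJY (norm_nonneg _) (mul_nonneg hε hCst))
  have t3 : ‖((gradC (lev L k) M μ * X₀)ᴴ
      * ((faceK (lev L k) L M μ)ᴴ * calG (L * lev L k) (one_le_lev' L (k + 1)) M a ha * faceK (lev L k) L M μ' - calGlev L M a ha k)
      * (gradC (lev L k) M μ' * Y₀)) p r‖ ≤ β * (CK d L a * ((L : ℝ)⁻¹) ^ k) * β :=
    (norm_conjTranspose_mul_mul_apply_le _ _ _ p r).trans
      (mul_le_mul (mul_le_mul hXg hS (norm_nonneg _) hβ) hYg (norm_nonneg _) (mul_nonneg hβ hσ))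
  calc _ ≤ ‖(X₁ᴴ * Ropsucc L M a ha k μ μ' * (Y₁ - Jpc L M k * Y₀)) p r
            + ((X₁ - Jpc L M k * X₀)ᴴ * Ropsucc L M a ha k μ μ' * (Jpc L M k * Y₀)) p r‖
          + ‖((gradC (lev L k) M μ * X₀)ᴴ
            * ((faceK (lev L k) L M μ)ᴴ * calG (L * lev L k) (one_le_lev' L (k + 1)) M a ha * faceK (lev L k) L M μ'
              - calGlev L M a ha k) * (gradC (lev L k) M μ' * Y₀)) p r‖ := norm_add_le _ _
    _ ≤ (α * Cst d a * ε + ε * Cst d a * α) + β * (CK d L a * ((L : ℝ)⁻¹) ^ k) * β :=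
        add_le_add ((norm_add_le _ _).trans (add_le_add t1 t2)) t3
    _ = 2 * (α * Cst d a * ε) + β * (CK d L a * ((L : ℝ)⁻¹) ^ k) * β := by ring

end Generic

/-! ## §3 The instance: the chain «soft leg · ∇ᴴ𝒢∇ · soft leg» and its unconditional one-step sup rate -/

/-- **THE ORDER-ZERO-SLOT CHAIN OF THE SOFT LEGS** `W^R_k(μ,μ′) := M̃_kᴴ·R_k(μ,μ′)·M̃_k` on the unit lattice: entries `⟨M̃_ke_p, R_kM̃_ke_r⟩ =
⟨∇_μM̃_ke_p, 𝒢_k∇_{μ′}M̃_ke_r⟩`, i.e. the physical `⟨∇_μu_p, 𝒢_k∇_{μ′}u_r⟩_{L²(T_η)}` for the soft legs `u = √(n_k^d)·M̃e`. [folklore] -/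
def ozChain (k : ℕ) (μ μ' : Fin d) : Matrix (idx L M 0) (idx L M 0) ℂ := (Mtil L M a ha k)ᴴ * Rop L M a ha k μ μ' * Mtil L M a ha k

/-- the same at the syntactic successor level (identity transport). [folklore] -/
theorem ozChain_succ (k : ℕ) (μ μ' : Fin d) :
    ozChain L M a ha (k + 1) μ μ'
      = (atSucc' L M k (Mtil L M a ha (k + 1)))ᴴ * Ropsucc L M a ha k μ μ' * atSucc' L M k (Mtil L M a ha (k + 1)) := rfl

/-- **LEIBNIZ (exact) for the soft legs**: `W^R_{k+1} − W^R_k = M̃′ᴴR′(M̃′ − JM̃) + (M̃′ − JM̃)ᴴR′(JM̃) + M̃ᴴ(JᴴR′J − R)M̃`. [folklore] -/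
theorem ozChain_succ_sub_eq (k : ℕ) (μ μ' : Fin d) :
    ozChain L M a ha (k + 1) μ μ' - ozChain L M a ha k μ μ'
      = (atSucc' L M k (Mtil L M a ha (k + 1)))ᴴ * Ropsucc L M a ha k μ μ'
            * (atSucc' L M k (Mtil L M a ha (k + 1)) - Jpc L M k * Mtil L M a ha k)
        + (atSucc' L M k (Mtil L M a ha (k + 1)) - Jpc L M k * Mtil L M a ha k)ᴴ * Ropsucc L M a ha k μ μ'
            * (Jpc L M k * Mtil L M a ha k)
        + (Mtil L M a ha k)ᴴ * ((Jpc L M k)ᴴ * Ropsucc L M a ha k μ μ' * Jpc L M k - Rop L M a ha k μ μ') * Mtil L M a ha k := by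
  rw [ozChain_succ, ozChain]; exact legChain_sub_eq _ _ _ _ _ _ _

/-- **THE THIRD SLOT, FACTORED THROUGH THE GRADIENT LEGS** (exact): `M̃_kᴴ·(J_kᴴR_{k+1}J_k − R_k)·M̃_k =
(∇_{k,μ}M̃_k)ᴴ·(K_μᴴ𝒢_{k+1}K_{μ′} − 𝒢_k)·(∇_{k,μ′}M̃_k)` — the differenced ORDER-ZERO slot is seen by its H¹ NEIGHBOURS only through their
gradients. [folklore] -/
theorem slot₃_eq (k : ℕ) (μ μ' : Fin d) :
    (Mtil L M a ha k)ᴴ * ((Jpc L M k)ᴴ * Ropsucc L M a ha k μ μ' * Jpc L M k - Rop L M a ha k μ μ') * Mtil L M a ha k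
      = (gradC (lev L k) M μ * Mtil L M a ha k)ᴴ
          * ((faceK (lev L k) L M μ)ᴴ * calG (L * lev L k) (one_le_lev' L (k + 1)) M a ha * faceK (lev L k) L M μ' - calGlev L M a ha k)
          * (gradC (lev L k) M μ' * Mtil L M a ha k) := by
  have h' : (Jpc L M k)ᴴ * Ropsucc L M a ha k μ μ' * Jpc L M k - Rop L M a ha k μ μ'
      = (gradC (lev L k) M μ)ᴴ * ((faceK (lev L k) L M μ)ᴴ * calG (L * lev L k) (one_le_lev' L (k + 1)) M a ha
          * faceK (lev L k) L M μ' - calGlev L M a ha k) * gradC (lev L k) M μ' := sandwich_orderZero_sub_eq_lev L M a ha k μ μ'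
  rw [h', Matrix.conjTranspose_mul]
  simp only [Matrix.mul_assoc]

/-- **THE «leg · ∇ᴴ𝒢∇ · leg» CHAIN IS ENTRYWISE CAUCHY AT RATE `L^{−k}`, UNCONDITIONALLY** (`d ≥ 1`): for all unit sites∕components `p r`,
all directions `μ μ′`, every `k`,
`‖W^R_{k+1}(μ,μ′)(p,r) − W^R_k(μ,μ′)(p,r)‖ ≤ (2·(a·Cst)·Cst·(a·CQH) + (a·Cst)²·CK(d,L,a))·L^{−k}` — value legs in `ℓ²` against the BOUNDED
order-zero slot (slots 1–2, `opNorm_Mtil_succ_sub_le`), the differenced order-zero slot against the legs' GRADIENTS (slot 3, the face-planted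
King law, `‖∇_{k,μ}M̃_k‖ ≤ a·Cst`); no sup letter, no weights, no sub-averaging.  R7 S3 (ρ2) for the soft legs. [folklore] -/
theorem norm_ozChain_succ_sub_le (hd : 1 ≤ d) (k : ℕ) (μ μ' : Fin d) (p r : idx L M 0) :
    ‖(ozChain L M a ha (k + 1) μ μ' - ozChain L M a ha k μ μ') p r‖
      ≤ (2 * ((a * Cst d a) * Cst d a * (a * CQH d a)) + (a * Cst d a) * (a * Cst d a) * CK d L a) * ((L : ℝ)⁻¹) ^ k := by
  have hA : ‖Mtil L M a ha k‖ ≤ a * Cst d a := opNorm_Mtil_le L M a ha k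
  have hD : ‖atSucc' L M k (Mtil L M a ha (k + 1)) - Jpc L M k * Mtil L M a ha k‖ ≤ a * CQH d a * ((L : ℝ)⁻¹) ^ k :=
    opNorm_Mtil_succ_sub_le L M a ha k
  have h := norm_legChain_sub_le L M a ha hd k μ μ' (atSucc' L M k (Mtil L M a ha (k + 1))) (atSucc' L M k (Mtil L M a ha (k + 1)))
    (Mtil L M a ha k) (Mtil L M a ha k) (mul_nonneg ha.le (Cst_nonneg d a)) ((norm_nonneg _).trans hD)
    (mul_nonneg ha.le (Cst_nonneg d a)) (opNorm_Mtil_le L M a ha (k + 1)) hA hD hD (opNorm_grad_Mtil_le L M a ha k μ)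
    (opNorm_grad_Mtil_le L M a ha k μ') p r
  rw [ozChain_succ, ozChain]
  refine h.trans (le_of_eq ?_)
  ring

end Summit.QuantumFields.BalabanUV.Beta.GAN24.SoftColumnOrderZeroChain

end
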